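import Literature.Computability.QuantumComplexity.CWrapAssembly
import Literature.Computability.QuantumComplexity.CWrapKernel
import Literature.Computability.QuantumComplexity.OracleCoinUniform
import Literature.Computability.QuantumComplexity.CoinFamilyKernel
import HarnessLib

/-!
# Hadamard coins in front of an input-recoverable uniform quantum family (randomised classical wrapping)

Topic `Literature/Computability/QuantumComplexity`; infrastructure for the machine form of the
AVERAGE-CASE-TO-WORST-CASE bridge for search-`LWE` (hypothesis `h₁` of
`Literature.Computability.Cryptography.regev_lwe_to_sivp_quantum_of_worstCase`,
`Cryptography/RegevDGSReductionWorstCase.lean`; Regev 2009, proof of Lemma 4.1: the random shift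
`(a, b) ↦ (a, b + ⟨a, t⟩)` with `t` uniform, repeated with fresh randomness), and more generally
for every reduction whose classical pre-processing of a quantum subroutine is RANDOMISED.

In the tree's model (G11 circuit families over Clifford+T, `Cryptography/QuantumCircuit.lean`) a
family receives `|x⟩|0…0⟩`; its only source of randomness is measurement, and classical coins are
realised by a layer of Hadamard gates on ancilla wires (Bernstein–Vazirani 1997, proof of Thm. 8.3
`BPP ⊆ BQP`: "the Fourier transform on the second track gives `Σ_y 2^{-p(n)/2} |x⟩|y⟩`"). The tree's
`coinFamily p m D` (`BQPProofs.lean`) is that layer followed by an arbitrary part `D n`; its output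
law is known when `D` is CLASSICAL (`CoinFamilyKernel.lean`). This file treats a QUANTUM part: the
circuit, at input length `n + k(n)`, of a given family `F`, which thus runs on the basis input
`x ++ c` for a uniformly random coin string `c ∈ {0,1}^{k(|x|)}`:

* `CoinPrefix.family P` (`P = ⟨F, pc⟩`, `k = pc.eval`): `coinFamily k mW body` with
  `body n = F.circ (n + k n)` re-typed onto `n + (k n + F.ancillas (n + k n))` wires;
  `family_isOracleFree`, **`family_isUniform`** (from `F.IsUniform`: print the Hadamard layer, then
  the description of `F` at `1^{n + k(n)}` verbatim);
* **`kernelProb_family_eq`** — if `F` is *input-recoverable* (`QCircuitFamily.InputRecoverable`: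
  the basis input can be read off every basis label in the support of the output state, by a map
  depending only on the input length — true of every family that keeps (a reversible image of) its
  input, in particular of the classical wraps `CWrap.family`, `CWrap.inputRecoverable`), then for
  every input `x` and event `E`

    `Pr[family outputs ∈ E on x] = 2^{-k(|x|)} · Σ_{c ∈ {0,1}^{k(|x|)}} Pr[F outputs ∈ E on x ++ c]`

  EXACTLY: the branches `|c⟩ ⊗ U_F |x c 0⟩` have pairwise disjoint supports in the computational
  basis, so no two coin values interfere (Nielsen–Chuang 2010, §2.2.5; the principle of deferred
  measurement, §4.4);
* the corollary for classical wraps, **`CoinCWrap.exists_family`**: for `h, g ∈ FP`, a uniform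
  oracle-free `F` and a coin polynomial `pc` there is a uniform oracle-free family `W` with, for
  every `x` and every relation `R`,

    `2^{-k} Σ_c Pr[F on h (x ++ c) outputs ∈ R (x ++ c)] ≤ Pr[W on x outputs a string with prefix g ⟨x ++ c, y⟩, some c, some y ∈ R (x ++ c)]`

  (`CWrap.kernelProb_family_ge` averaged over the coins) — randomised classical pre- and
  post-processing around one call of a quantum subroutine, as ONE uniform family.

Everything here is PROVED (definitions with bodies; theorems; no named fact).

## References

* E. Bernstein, U. Vazirani, *Quantum complexity theory*, SIAM J. Comput. 26 (1997) 1411–1473,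
  Thm. 8.3 (proof: Hadamard coins) and §8 [BernsteinVazirani1997].
* M. A. Nielsen, I. L. Chuang, *Quantum Computation and Quantum Information*, CUP 2010, §2.2.5
  (Born rule), §4.4 (principle of deferred measurement) [NielsenChuang2010].
* S. Arora, B. Barak, *Computational Complexity: A Modern Approach*, CUP 2009, §6.2 and Remark 6.7
  (P-uniform families printed with counters) [AroraBarak2009].
* O. Regev, *On lattices, learning with errors, random linear codes, and cryptography*, J. ACM 56
  (2009), art. 34, proof of Lemma 4.1 (the consumer: random self-reduction of `LWE` in the secret)
  [Regev2009].
-/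

noncomputable section

namespace Literature.Computability.QuantumComplexity

open _root_.Computability Polynomial Complexity Complexity.Brick Plumb RevDesc RevSim RevClean Cryptography RevMux
  Complexity.GExpr Matrix Finset

/-! ### Registers re-typed along an equality of wire counts -/

section CastReg

variable {a b : ℕ}

/-- Re-typing a basis label along `a = b`. [folklore] -/
def castReg (h : a = b) (z : QReg a) : QReg b := z ∘ Fin.cast h.symm

/-- `castReg` evaluated. [folklore] -/
@[simp] theorem castReg_apply (h : a = b) (z : QReg a) (i : Fin b) : castReg h z i = z (Fin.cast h.symm i) := rfl

/-- Re-typing back and forth is the identity. [folklore] -/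
@[simp] theorem castReg_castReg (h : a = b) (z : QReg a) : castReg h.symm (castReg h z) = z := by
  funext i; simp [castReg]

/-- Re-typing forth and back is the identity. [folklore] -/
@[simp] theorem castReg_castReg' (h : a = b) (z : QReg b) : castReg h (castReg h.symm z) = z := by
  funext i; simp [castReg]

/-- Re-typing is a bijection of basis labels. [folklore] -/
def castRegEquiv (h : a = b) : QReg a ≃ QReg b :=
  ⟨castReg h, castReg h.symm, castReg_castReg h, castReg_castReg' h⟩

/-- `castRegEquiv` evaluated. [folklore] -/
@[simp] theorem castRegEquiv_apply (h : a = b) (z : QReg a) : castRegEquiv h z = castReg h z := rfl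

/-- Re-typing does not change the string read off a label. [folklore] -/
@[simp] theorem ofFn_castReg (h : a = b) (z : QReg a) : List.ofFn (castReg h z) = List.ofFn z := by
  subst h; rfl

/-- Composition with the cast embedding is re-typing. [folklore] -/
theorem comp_castLEEmb_eq_castReg (h : a = b) (z : QReg b) : z ∘ Fin.castLEEmb h.le = castReg h.symm z := rfl

/-- **A circuit placed along an equality of wire counts acts as the re-typed circuit.**
[cite: NielsenChuang2010, §4.3] -/
theorem placeGate_castLEEmb_eq_mulVec (h : a = b) (U : Matrix (QReg a) (QReg a) ℂ) (φ : QReg b → ℂ) (z : QReg b) :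
    (placeGate (Fin.castLEEmb h.le) U *ᵥ φ) z = (U *ᵥ fun w => φ (castReg h w)) (castReg h.symm z) := by
  subst h
  have hr : ∀ i : Fin a, i ∈ Set.range (Fin.castLEEmb (le_refl a)) := fun i => ⟨i, by ext; simp⟩
  rw [Matrix.mulVec, Matrix.mulVec]
  change ∑ w, placeGate (Fin.castLEEmb (le_refl a)) U z w * φ w = ∑ w, U (castReg rfl z) w * φ (castReg rfl w)
  refine Finset.sum_congr rfl fun w _ => ?_
  have h1 := placeGate_mulVec_basisState_apply (Fin.castLEEmb (le_refl a)) U w z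
  rw [mulVec_basisState] at h1
  change placeGate (Fin.castLEEmb (le_refl a)) U z w = _ at h1
  rw [h1, if_pos (fun i hi => absurd (hr i) hi)]
  rfl

end CastReg

/-! ### The output state of a family on a basis input, at a variable input length -/

namespace QCircuitFamilyState

open Cryptography.QCircuitFamily

variable (F : QCircuitFamily cliffordT)

/-- The output state of `F` at input length `N` on the basis input `u`: `U_{F.circ N} |u⟩|0…0⟩`.
[folklore] -/
def Ψ (N : ℕ) (u : QReg N) : QReg (N + F.ancillas N) → ℂ :=
  (F.circ N).runOn 0 (basisState (padInput u (F.ancillas N)))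

/-- Transport of `Ψ` along an equality of input lengths. [folklore] -/
theorem Ψ_cast {N N' : ℕ} (h : N = N') (u : QReg N) (z : QReg (N' + F.ancillas N')) :
    Ψ F N' (castReg h u) z = Ψ F N u (castReg (by rw [h]) z) := by
  subst h; rfl

/-- **The kernel of a family as a Born sum of `Ψ` at any name of the input length.** [cite: NielsenChuang2010, §2.2.5] -/
theorem kernelProb_eq_sum_Ψ (x : List Bool) {N : ℕ} (h : x.length = N) (E : Set (List Bool)) [DecidablePred (· ∈ E)] :
    F.kernelProb 0 x E = ∑ z : QReg (N + F.ancillas N),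
      if List.ofFn z ∈ E then ‖Ψ F N (castReg h x.get) z‖ ^ 2 else 0 := by
  subst h
  exact toReal_outputPMF_map_ofFn (A := 0) (F.circ x.length) x.get E

end QCircuitFamilyState

open QCircuitFamilyState

/-- **Input-recoverable families**: some map `ρ N` of basis labels, depending only on the input
length `N`, returns the basis input `u` on every label in the support of the output state of
`F.circ N` on `|u⟩|0…0⟩`. Families that keep their input register, or move it reversibly, are
input-recoverable; such families never let two distinct basis inputs interfere.
[cite: NielsenChuang2010, §4.4 (principle of deferred measurement)] -/
def _root_.Literature.Computability.Cryptography.QCircuitFamily.InputRecoverable (F : QCircuitFamily cliffordT) : Prop :=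
  ∃ ρ : (N : ℕ) → QReg (N + F.ancillas N) → QReg N,
    ∀ (N : ℕ) (u : QReg N) (z : QReg (N + F.ancillas N)), Ψ F N u z ≠ 0 → ρ N z = u

end Literature.Computability.QuantumComplexity

namespace Literature.Computability.QuantumComplexity

open _root_.Computability Polynomial Complexity Complexity.Brick Plumb RevDesc RevSim RevClean Cryptography RevMux
  Complexity.GExpr Matrix Finset QCircuitFamilyState

/-! ### Register bookkeeping: `x c 0^m` re-typed, and the list `x ++ c` -/

section Regs

variable {n k m : ℕ}

/-- `|x⟩|c⟩|0^m⟩` on `n + (k + m)` wires, re-typed onto `(n + k) + m` wires, is `|x c⟩|0^m⟩`. [folklore] -/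
theorem castReg_coinInput (x : QReg n) (c : QReg k) :
    castReg (Nat.add_assoc n k m).symm (coinInput (m := m) x c) = padInput (Fin.append x c) m := by
  funext i
  simp only [castReg_apply]
  induction i using Fin.addCases with
  | left j =>
    rw [padInput, Fin.append_left]
    induction j using Fin.addCases with
    | left j' =>
      have e : Fin.cast (Nat.add_assoc n k m).symm.symm (Fin.castAdd m (Fin.castAdd k j')) = Fin.castAdd (k + m) j' :=
        Fin.ext rfl
      rw [e, Fin.append_left, coinInput, Fin.append_left]
    | right c' =>
      have e : Fin.cast (Nat.add_assoc n k m).symm.symm (Fin.castAdd m (Fin.natAdd n c')) =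
          Fin.natAdd n (Fin.castAdd m c') := Fin.ext rfl
      rw [e, Fin.append_right, coinInput, Fin.append_right, Fin.append_left]
  | right l =>
    have e : Fin.cast (Nat.add_assoc n k m).symm.symm (Fin.natAdd (n + k) l) = Fin.natAdd n (Fin.natAdd k l) :=
      Fin.ext (Nat.add_assoc n k l)
    rw [e, padInput, Fin.append_right, coinInput, Fin.append_right, Fin.append_right]

/-- The length of `x ++ c`. [folklore] -/
theorem length_append_ofFn (x : List Bool) (c : QReg k) : (x ++ List.ofFn c).length = x.length + k := by
  simp

/-- Reading the list `x ++ c` as a register on `|x| + k` wires gives `x c`. [folklore] -/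
theorem castReg_get_append_ofFn (x : List Bool) (c : QReg k) (h : (x ++ List.ofFn c).length = x.length + k) :
    castReg h (x ++ List.ofFn c).get = Fin.append x.get c := by
  funext i
  simp only [castReg_apply]
  induction i using Fin.addCases with
  | left j =>
    rw [Fin.append_left, List.get_eq_getElem, List.get_eq_getElem]
    simp only [Fin.val_cast, Fin.val_castAdd]
    exact List.getElem_append_left (by simp)
  | right l =>
    rw [Fin.append_right, List.get_eq_getElem]
    simp only [Fin.val_cast, Fin.val_natAdd]
    rw [List.getElem_append_right (by simp)]
    simp

/-- `Fin.append x` is injective. [folklore] -/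
theorem append_right_injective (x : QReg n) : Function.Injective (Fin.append (n := k) x) := by
  intro c c' h
  funext j
  have := congrFun h (Fin.natAdd n j)
  rwa [Fin.append_right, Fin.append_right] at this

end Regs

/-! ### The coin-prefixed family -/

namespace CoinPrefix

/-- The data (a hypothesis structure): the family `F` run behind the coins and the coin
polynomial `pc` (`k(n) = pc(n)` coins on inputs of length `n`). [folklore] -/
structure Params where
  /-- the family run on `x ++ c` -/
  F : QCircuitFamily cliffordT
  /-- the number of coins, as a polynomial in the input length -/
  pc : Polynomial ℕ

variable (P : Params)

/-- The number of coins `k(n)` (an `abbrev`: it occurs in types). [folklore] -/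
abbrev k (n : ℕ) : ℕ := P.pc.eval n

/-- The input length of `F`: `n + k(n)` (an `abbrev`: it occurs in types). [folklore] -/
abbrev nIn (n : ℕ) : ℕ := n + k P n

/-- The work wires: the ancillas of `F` at input length `n + k(n)` (an `abbrev`). [folklore] -/
abbrev mW (n : ℕ) : ℕ := P.F.ancillas (nIn P n)

/-- The two associations of the wire count. [folklore] -/
theorem width_eq (n : ℕ) : nIn P n + mW P n = n + (k P n + mW P n) := Nat.add_assoc _ _ _

/-- The quantum part: `F.circ (n + k n)` re-typed onto `n + (k n + mW n)` wires. [folklore] -/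
def body (n : ℕ) : QCircuit cliffordT (n + (k P n + mW P n)) :=
  mapWires (Fin.castLEEmb (width_eq P n).le) (P.F.circ (nIn P n))

/-- **The coin-prefixed family**: `k(n)` Hadamard coins, then `F` at input length `n + k(n)` on
`|x⟩|c⟩|0…0⟩` (an `abbrev`, like `coinFamily`, so that `ancillas n` unfolds to `k n + mW n` in
types). [cite: BernsteinVazirani1997, Thm. 8.3 (proof: the coin layer)] -/
abbrev family : QCircuitFamily cliffordT := coinFamily (k P) (mW P) (body P)

/-- The ancilla count of the coin-prefixed family. [folklore] -/
theorem family_ancillas (n : ℕ) : (family P).ancillas n = k P n + mW P n := rfl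

/-- The circuit of the coin-prefixed family. [folklore] -/
theorem family_circ (n : ℕ) :
    (family P).circ n = (⟨hadamardLayer n (k P n) (mW P n)⟩ : QCircuit cliffordT _).append (body P n) := rfl

/-- The coin-prefixed family is oracle-free if `F` is. [folklore] -/
theorem family_isOracleFree (hF : P.F.IsOracleFree) : (family P).IsOracleFree :=
  coinFamily_isOracleFree fun n => isOracleFree_mapWires _ (hF (nIn P n))

/-! ### The output state -/

/-- **The output state**: `2^{-k/2} Σ_c (body |x c 0⟩)`. [cite: BernsteinVazirani1997, Thm. 8.3 (proof)] -/
theorem runOn_family (x : List Bool) :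
    ((family P).circ x.length).runOn 0 (basisState (padInput x.get (k P x.length + mW P x.length))) =
      invSqrt2 ^ k P x.length • ∑ c : QReg (k P x.length), (body P x.length).mat *ᵥ basisState (coinInput x.get c) := by
  change QCircuit.toMatrix 0 ((⟨hadamardLayer x.length (k P x.length) (mW P x.length)⟩ : QCircuit cliffordT _).append
    (body P x.length)) *ᵥ _ = _
  rw [QCircuit.toMatrix_append, ← Matrix.mulVec_mulVec, hadamardLayer_mulVec_padInput, Matrix.mulVec_smul, Matrix.mulVec_sum]

/-- **The branch of coin value `c` is the output state of `F` on `x ++ c`**, re-typed. [folklore] -/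
theorem body_mulVec_coinInput (n : ℕ) (x : QReg n) (c : QReg (k P n)) (z : QReg (n + (k P n + mW P n))) :
    ((body P n).mat *ᵥ basisState (coinInput x c)) z = Ψ P.F (nIn P n) (Fin.append x c) (castReg (width_eq P n).symm z) := by
  rw [body, QCircuit.mat, toMatrix_mapWires, placeGate_castLEEmb_eq_mulVec (width_eq P n)]
  unfold Ψ QCircuit.runOn
  congr 2
  funext w
  rw [basisState_apply, basisState_apply]
  have e : (castReg (width_eq P n) w = coinInput x c) ↔ (w = padInput (Fin.append x c) (mW P n)) := by
    rw [← castReg_coinInput (m := mW P n) x c]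
    constructor
    · intro h; rw [← h]; exact (castReg_castReg (width_eq P n) w).symm
    · intro h; rw [h]; exact castReg_castReg' (width_eq P n) _
  exact if_congr e rfl rfl

/-! ### The exact mixture law -/

/-- **No interference between coin values** (input-recoverable `F`): at every basis label at most
one branch is nonzero, so the squared norm of the sum is the sum of the squared norms.
[cite: NielsenChuang2010, §4.4 (principle of deferred measurement)] -/
theorem normSq_sum_branch (hρ : P.F.InputRecoverable) {n : ℕ} (x : QReg n) (z : QReg (nIn P n + mW P n)) :
    ‖∑ c : QReg (k P n), Ψ P.F (nIn P n) (Fin.append x c) z‖ ^ 2 =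
      ∑ c : QReg (k P n), ‖Ψ P.F (nIn P n) (Fin.append x c) z‖ ^ 2 := by
  classical
  obtain ⟨ρ, hρ⟩ := hρ
  by_cases h0 : ∀ c : QReg (k P n), Ψ P.F (nIn P n) (Fin.append x c) z = 0
  · simp [h0]
  · obtain ⟨c₀, hc₀⟩ := not_forall.1 h0
    have huniq : ∀ c, Ψ P.F (nIn P n) (Fin.append x c) z ≠ 0 → c = c₀ := fun c hc =>
      append_right_injective x ((hρ _ _ _ hc).symm.trans (hρ _ _ _ hc₀))
    rw [Finset.sum_eq_single c₀ (fun c _ hc => not_not.1 fun h => hc (huniq c h)) (fun h => absurd (mem_univ _) h),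
      Finset.sum_eq_single c₀ (fun c _ hc => by rw [not_not.1 fun h => hc (huniq c h)]; simp)
        (fun h => absurd (mem_univ _) h)]

/-- **The exact mixture law of the coin-prefixed family**: for an input-recoverable `F`,
`Pr[family outputs ∈ E on x] = 2^{-k(|x|)} Σ_{c ∈ {0,1}^{k(|x|)}} Pr[F outputs ∈ E on x ++ c]`.
[cite: BernsteinVazirani1997, Thm. 8.3 (proof); NielsenChuang2010 §2.2.5, §4.4] -/
theorem kernelProb_family_eq (hρ : P.F.InputRecoverable) (x : List Bool) (E : Set (List Bool)) :
    (family P).kernelProb 0 x E =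
      (1 / 2 : ℝ) ^ k P x.length * ∑ c : QReg (k P x.length), P.F.kernelProb 0 (x ++ List.ofFn c) E := by
  classical
  -- the coin-prefixed family's kernel as a Born sum
  have hK : (family P).kernelProb 0 x E = ∑ z : QReg (x.length + (k P x.length + mW P x.length)),
      if List.ofFn z ∈ E then ‖((family P).circ x.length).runOn 0 (basisState (padInput x.get (k P x.length + mW P x.length))) z‖ ^ 2
      else 0 :=
    toReal_outputPMF_map_ofFn (A := 0) ((family P).circ x.length) x.get E
  -- each branch's kernel as a Born sum of `Ψ` at length `nIn`
  have hF : ∀ c : QReg (k P x.length), P.F.kernelProb 0 (x ++ List.ofFn c) E =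
      ∑ z : QReg (x.length + (k P x.length + mW P x.length)),
        if List.ofFn z ∈ E then ‖Ψ P.F (nIn P x.length) (Fin.append x.get c) (castReg (width_eq P x.length).symm z)‖ ^ 2 else 0 := by
    intro c
    rw [kernelProb_eq_sum_Ψ P.F (x ++ List.ofFn c) (length_append_ofFn x c) E, castReg_get_append_ofFn]
    rw [← Fintype.sum_equiv (castRegEquiv (width_eq P x.length).symm) _ _ (fun z => rfl)]
    refine Finset.sum_congr rfl fun z _ => ?_
    simp only [castRegEquiv_apply, ofFn_castReg]
  rw [hK, Finset.mul_sum]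
  simp_rw [hF, Finset.mul_sum]
  rw [Finset.sum_comm]
  refine Finset.sum_congr rfl fun z _ => ?_
  rw [← Finset.mul_sum]
  split_ifs with hz
  · rw [runOn_family]
    simp only [Pi.smul_apply, Finset.sum_apply, smul_eq_mul, norm_mul, mul_pow, norm_invSqrt2_pow_sq]
    congr 1
    simp_rw [body_mulVec_coinInput]
    exact normSq_sum_branch P hρ x.get _
  · simp

/-- **The averaged form**: `2^{-k} Σ_c Pr[F on x ++ c ∈ E_c] ≤ Pr[family on x ∈ ⋃_c E_c]` for any
coin-indexed events (each branch's event is contained in the union). [folklore] -/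
theorem sum_kernelProb_le (hρ : P.F.InputRecoverable) (x : List Bool) (E : QReg (k P x.length) → Set (List Bool)) :
    (1 / 2 : ℝ) ^ k P x.length * ∑ c : QReg (k P x.length), P.F.kernelProb 0 (x ++ List.ofFn c) (E c) ≤
      (family P).kernelProb 0 x {z | ∃ c, z ∈ E c} := by
  rw [kernelProb_family_eq P hρ]
  refine mul_le_mul_of_nonneg_left (Finset.sum_le_sum fun c _ => ?_) (by positivity)
  refine ENNReal.toReal_mono (ne_top_of_le_ne_top ENNReal.one_ne_top ?_) ((P.F.kernel 0 _).toOuterMeasure_mono fun z hz => ⟨c, hz.1⟩)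
  rw [← ((P.F.kernel 0 (x ++ List.ofFn c)).toOuterMeasure_apply_eq_one_iff Set.univ).2 (Set.subset_univ _)]
  exact (P.F.kernel 0 _).toOuterMeasure_mono (Set.subset_univ _)

/-! ### Uniformity -/

section Uniform

/-- **The description of the circuit**: the Hadamard layer, then the code of `F.circ (n + k n)`
VERBATIM (placing along the front wires does not change gate codes). [cite: AroraBarak2009, §6.2] -/
theorem encode_circ (n : ℕ) :
    QCircuit.encode ((family P).circ n) =
      ((List.range (k P n)).map fun j => RazTalMachine.RtOp.had (n + j)).flatMap RazTalMachine.RtOp.bits ++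
        (P.F.circ (nIn P n)).encode := by
  rw [family_circ, QCircuit.append, encode_eq_flatMap, List.flatMap_append, OCoin.flatMap_gateEnc_hadamardLayer]
  congr 1
  rw [body, show (P.F.circ (nIn P n)).encode = QCircuit.encode (⟨(P.F.circ (nIn P n)).gates⟩ : QCircuit cliffordT _) from rfl,
    encode_eq_flatMap]
  simp only [mapWires, List.flatMap_map, CWrap.gateEnc_mapWiresGate_castLEEmb]

/-- The generator of the Hadamard layer: `H` on the coin wires `u + j`, `j < k(u)`. [folklore] -/
def hadsG : GS := .loop .jj (CWrap.polyE P.pc (.var .uu)) (PhaseQuery.hadG (.add (.var .uu) (.var .jj)))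

/-- The Hadamard generator prints the Hadamard tokens. [folklore] -/
theorem out_hadsG (u : ℕ) :
    (hadsG P).out (envU u) = ((List.range (k P u)).map fun j => RazTalMachine.RtOp.had (u + j)).flatMap RazTalMachine.RtOp.toks := by
  simp [hadsG, GStmt.out, List.flatMap_map, GExpr.eval, envU]

/-- Hygiene of the Hadamard generator. [folklore] -/
theorem hygiene_hadsG : GV.uu ∉ (hadsG P).loopVars ∧ (hadsG P).noReuse = true := by
  have hjj : (GV.jj = .ii ∨ GV.jj = .jj) := Or.inr rfl
  have hlv : LV (fun x => x = .ii ∨ x = .jj) (hadsG P) := lv_loop hjj (PhaseQuery.lv_agateG (Or.inl rfl) _)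
  refine ⟨fun hu => ?_, ?_⟩
  · rcases hlv _ hu with h | h <;> exact absurd h (by decide)
  · exact noReuse_loop_of (PhaseQuery.lv_agateG (Q := (· ≠ GV.jj)) (by decide) _) (PhaseQuery.noReuse_agateG _)

/-- The Hadamard-layer description. [folklore] -/
def hadF : List Bool → List Bool := PhaseQuery.g1F (hadsG P)

/-- `hadF ∈ FP`. [folklore] -/
theorem hadF_mem_FP : hadF P ∈ FP := PhaseQuery.g1F_mem_FP _ (hygiene_hadsG P).1 (hygiene_hadsG P).2

/-- `hadF` prints the Hadamard layer. [folklore] -/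
theorem hadF_apply (z : List Bool) :
    hadF P z = ((List.range (k P z.length)).map fun j => RazTalMachine.RtOp.had (z.length + j)).flatMap RazTalMachine.RtOp.bits := by
  rw [hadF, PhaseQuery.g1F, out_hadsG, PhaseQuery.render_rtoks_nil]

/-- The padded argument `z ++ 1^{k |z|}`, of length `nIn |z|`. [folklore] -/
def wF (z : List Bool) : List Bool := z ++ polyFn P.pc z

/-- `wF ∈ FP`. [folklore] -/
theorem wF_mem_FP : wF P ∈ FP := append_mem_FP (f := fun z => z) (PolyTimeComputable.id _) (polyFn_mem_FP P.pc)

/-- The length of `wF z`. [folklore] -/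
theorem length_wF (z : List Bool) : (wF P z).length = nIn P z.length := by
  simp [wF, nIn, k, ones]

/-- The description of `F` at `1^{n + k n}`, read through `wF`. [folklore] -/
theorem descFn_wF (z : List Bool) :
    P.F.descFn (wF P z) = boolPair (encodeNat (nIn P z.length))
      (boolPair (unaryEncodeNat (mW P z.length)) (P.F.circ (nIn P z.length)).encode) := by
  rw [QCircuitFamily.descFn_eq, length_wF]

/-- The ancilla count in unary: `1^{k n} ++ 1^{mW n}`. [folklore] -/
def ancF : List Bool → List Bool := fun z => polyFn P.pc z ++ fstF (sndF (P.F.descFn (wF P z)))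

/-- `ancF ∈ FP` (for uniform `F`). [folklore] -/
theorem ancF_mem_FP (hU : P.F.IsUniform) : ancF P ∈ FP :=
  append_mem_FP (polyFn_mem_FP P.pc) (comp_mem_FP fstF_mem_FP (comp_mem_FP sndF_mem_FP
    (comp_mem_FP (QCircuitFamily.descFn_mem_FP_of_isUniform hU) (wF_mem_FP P))))

/-- `ancF` prints the ancilla count of the coin-prefixed family. [folklore] -/
theorem ancF_apply (z : List Bool) : ancF P z = unaryEncodeNat (k P z.length + mW P z.length) := by
  change polyFn P.pc z ++ fstF (sndF (P.F.descFn (wF P z))) = _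
  rw [descFn_wF, sndF_boolPair, fstF_boolPair, polyFn_apply, RevDesc.unaryEncodeNat_eq_replicate,
    RevDesc.unaryEncodeNat_eq_replicate, List.replicate_add]

/-- The body description: the code of `F.circ (n + k n)`. [folklore] -/
def bodyF : List Bool → List Bool := fun z => sndF (sndF (P.F.descFn (wF P z)))

/-- `bodyF ∈ FP` (for uniform `F`). [folklore] -/
theorem bodyF_mem_FP (hU : P.F.IsUniform) : bodyF P ∈ FP :=
  comp_mem_FP sndF_mem_FP (comp_mem_FP sndF_mem_FP (comp_mem_FP (QCircuitFamily.descFn_mem_FP_of_isUniform hU) (wF_mem_FP P)))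

/-- `bodyF` prints the code of `F.circ (n + k n)`. [folklore] -/
theorem bodyF_apply (z : List Bool) : bodyF P z = (P.F.circ (nIn P z.length)).encode := by
  change sndF (sndF (P.F.descFn (wF P z))) = _
  rw [descFn_wF, sndF_boolPair, sndF_boolPair]

/-- **The coin-prefixed family of a uniform family is uniform**: print `bin n`, the unary ancilla
count, the Hadamard layer, and the description of `F` at `1^{n + k(n)}` verbatim.
[cite: AroraBarak2009, §6.2 Def. 6.12 and Remark 6.7 (descriptions printed in polynomial time)] -/
theorem family_isUniform (hU : P.F.IsUniform) : (family P).IsUniform := by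
  refine QCircuitFamily.isUniform_of_descFn_mem_FP ?_
  have h := fanoutFn_mem_FP lenBinF_mem_FP (fanoutFn_mem_FP (ancF_mem_FP P hU)
    (append_mem_FP (hadF_mem_FP P) (bodyF_mem_FP P hU)))
  have e : (family P).descFn = fanoutFn lenBinF (fanoutFn (ancF P) (fun z => hadF P z ++ bodyF P z)) := by
    funext z
    rw [fanoutFn_apply, fanoutFn_apply, lenBinF_apply, ancF_apply, QCircuitFamily.descFn_eq, hadF_apply, bodyF_apply,
      encode_circ]
  rw [e]
  exact h

end Uniform

end CoinPrefix

/-! ### Classical wraps are input-recoverable -/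

namespace CWrap

variable (P : CWrap.Params)

/-- Stage 2 of the classical wrap as a bijection of the basis labels. [folklore] -/
def unperm2 (n : ℕ) : QReg (n + anc P n) ≃ QReg (n + anc P n) := (perm2 P n).equivOfFiniteSelfEmbedding

/-- **Reading the input off an output label of the classical wrap**: undo stage 2, read the first
`n` wires. [folklore] -/
def readIn (n : ℕ) (y : QReg (n + anc P n)) : QReg n := fun i => (unperm2 P n).symm y (Fin.castAdd (anc P n) i)

/-- Transport of `readIn` along an equality of input lengths. [folklore] -/
theorem readIn_cast {n n' : ℕ} (h : n = n') (y : QReg (n' + anc P n')) :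
    readIn P n' y = castReg h (readIn P n (castReg (by rw [h]) y)) := by
  subst h; rfl

/-- The output state of the classical wrap, entrywise: the product state pulled back along stage 2.
[folklore] -/
theorem Ψ_family_apply (x : List Bool) (y : QReg (x.length + anc P x.length)) :
    Ψ (family P) x.length x.get y = prodState (blockEmb P x) (blockState P x) (W1 P x) ((unperm2 P x.length).symm y) := by
  change (circ P x.length).runOn 0 (basisState (padInput x.get (anc P x.length))) y = _
  rw [runOn_circ, mulVec_eq_of_perm (perm2 P x.length) (toMatrix_stage2_mulVec_basisState P 0 x.length)]
  rfl

/-- **On the support of the output state, `readIn` returns the input.** [cite: NielsenChuang2010, §3.2.5 (garbage-free reversible computation keeps the input)] -/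
theorem readIn_eq_of_ne_zero (x : List Bool) (y : QReg (x.length + anc P x.length))
    (hy : Ψ (family P) x.length x.get y ≠ 0) : readIn P x.length y = x.get := by
  rw [Ψ_family_apply] at hy
  have hz : Agrees ((unperm2 P x.length).symm y) := by
    by_contra h
    apply hy
    have h' : ¬ (∀ w, OffBlocks (blockEmb P x) w → (unperm2 P x.length).symm y w = W1 P x w) := h
    rw [prodState_apply, if_neg h', zero_mul]
  funext i
  have hlt : ((Fin.castAdd (anc P x.length) i : Fin (x.length + anc P x.length)) : ℕ) < x.length := by simp
  have hoff : OffBlocks (blockEmb P x) (Fin.castAdd (anc P x.length) i) :=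
    offBlocks_of_lt_baseB (lt_of_lt_of_le hlt
      ((le_widthH P.toLayout x.length).trans (widthH_lt_baseB P.toLayout x.length).le))
  have h1 := hz _ hoff
  change (unperm2 P x.length).symm y (Fin.castAdd (anc P x.length) i) = x.get i
  rw [h1]
  change w1 P x ((Fin.castAdd (anc P x.length) i : Fin (x.length + anc P x.length)) : ℕ) = x.get i
  rw [w1_of_lt P x hlt]
  simp

/-- **Classical wraps are input-recoverable.** [cite: NielsenChuang2010, §3.2.5, §4.4] -/
theorem inputRecoverable : (family P).InputRecoverable := by
  refine ⟨readIn P, fun N u y hy => ?_⟩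
  have hx : (List.ofFn u).length = N := List.length_ofFn
  have hu : castReg hx (List.ofFn u).get = u := by funext i; simp [castReg]
  rw [← hu, Ψ_cast (family P) hx] at hy
  have h2 := readIn_eq_of_ne_zero P (List.ofFn u) _ hy
  rw [readIn_cast P hx]
  exact (congrArg (castReg hx) h2).trans hu

end CWrap

/-! ### Randomised classical wrapping: coins in front of a classical wrap -/

namespace CoinCWrap

/-- **Randomised classical pre- and post-processing around a quantum subroutine, as ONE uniform
family.** For `h, g ∈ FP`, a poly-time uniform oracle-free family `F` and a coin polynomial `pc`
there is a poly-time uniform oracle-free family `W` which, on input `x`, draws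
`c ∈ {0,1}^{pc(|x|)}` uniformly (Hadamard coins), computes `h (x ++ c)` cleanly, runs `F` on it,
computes `g ⟨x ++ c, y⟩` on the measured answer `y` and writes it in front: for every family of
events `S c` on the answers,

  `2^{-pc(|x|)} Σ_c Pr[F on h (x ++ c) outputs y ∈ S c] ≤ Pr[W on x outputs a string with prefix g ⟨x ++ c, y⟩ for some c and some y ∈ S c]`

(`CoinPrefix.sum_kernelProb_le` over `CWrap.kernelProb_family_ge`). [cite: BernsteinVazirani1997, Thm. 8.3 (proof) and §8 (classical computation inside quantum machines)] -/
theorem exists_family {h g : List Bool → List Bool} (hh : h ∈ FP) (hg : g ∈ FP)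
    {F : QCircuitFamily cliffordT} (hFfree : F.IsOracleFree) (hU : F.IsUniform) (pc : Polynomial ℕ) :
    ∃ W : QCircuitFamily cliffordT, W.IsOracleFree ∧ W.IsUniform ∧
      ∀ (x : List Bool) (S : QReg (pc.eval x.length) → Set (List Bool)),
        (1 / 2 : ℝ) ^ pc.eval x.length *
            ∑ c : QReg (pc.eval x.length), F.kernelProb 0 (h (x ++ List.ofFn c)) (S c) ≤
          W.kernelProb 0 x {z | ∃ c : QReg (pc.eval x.length), ∃ y ∈ S c, g (boolPair (x ++ List.ofFn c) y) <+: z} := by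
  obtain ⟨P₀, rfl, rfl, rfl⟩ := CWrap.exists_params hh hg hU
  let P : CoinPrefix.Params := ⟨CWrap.family P₀, pc⟩
  refine ⟨CoinPrefix.family P, CoinPrefix.family_isOracleFree P (CWrap.family_isOracleFree P₀ hFfree),
    CoinPrefix.family_isUniform P (CWrap.family_isUniform P₀ hU), fun x S => ?_⟩
  refine le_trans ?_ (CoinPrefix.sum_kernelProb_le P (CWrap.inputRecoverable P₀) x
    fun c => {z | ∃ y ∈ S c, P₀.g (boolPair (x ++ List.ofFn c) y) <+: z})
  refine mul_le_mul_of_nonneg_left (Finset.sum_le_sum fun c _ => ?_) (by positivity)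
  exact CWrap.kernelProb_family_ge P₀ (x ++ List.ofFn c) fun _ => S c

end CoinCWrap

end Literature.Computability.QuantumComplexity
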